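import Literature.Analysis.PDE.EvansKrylovSupersolutionAux
import Literature.Analysis.PDE.EvansKrylovAuxiliary
import HarnessLib

/-!
# Evans–Krylov: the functions `w_k = h_k + ε Σ_l h_l²` are supersolutions (GT (17.46)–(17.48))

Gilbarg–Trudinger, *Elliptic Partial Differential Equations of Second Order*, §17.4, p. 459:
in the proof of the interior `C^{2,α}` estimate for concave fully nonlinear equations
(Thm. 17.14) the pure second derivatives `D_{γ_kγ_k}u` along the Motzkin–Wasow directions
`γ_k` are normalised to `h_k = ½(1 + D_{γ_kγ_k}u/(1 + M₂)) ∈ [0,1]` (`M₂ ≥ |D²u|`), and the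
differentiated inequality (17.46) `-a : D²h_k ≤ (A₀|D³u| + B₀)/(2(1+M₂))` is combined with
(17.47) for `v = Σ h_k²`, the polarisation estimate `|D³u|² ≤ 4n³(1+M₂)² Σ_k |Dh_k|²` (the
directions contain all `e_i` and `(e_i ± e_j)/√2`), the ellipticity `λ Σ|Dh_k|² ≤ Σ a(Dh_k, Dh_k)`
and the Cauchy inequality, to give (17.48): `a : D²w_k ≥ -Φ₀/ε` for `w_k = h_k + εv`,
`ε ∈ (0,1]`, with `Φ₀` depending only on `n, N, λ, A₀, B₀, M₂`.

* `supersolution_w` — the statement above, at one point `y`, in the matrix format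
  `KrylovSafonov.pair a (ABP.hessianMatrix w e y)` consumed by `EvansKrylov.oscillation_decay`;
  the pointwise algebra is `EvansKrylov.pair_hessian_w_ge`, the calculus and the polarisation
  bound are in `Literature/Analysis/PDE/EvansKrylovSupersolutionAux.lean`.

Everything here is proved.

## References

* D. Gilbarg, N. S. Trudinger, *Elliptic Partial Differential Equations of Second Order* (2001),
  §17.4, (17.46)–(17.48). [GilbargTrudinger2001]
-/

noncomputable section

open Matrix Finset Metric Set Filter
open scoped Topology

namespace Literature.Analysis.PDE.EvansKrylov

open Literature.Analysis.Calculus Literature.Analysis.PDE.ABP Literature.Analysis.PDE.KrylovSafonov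

/-- **Gilbarg–Trudinger (17.46)–(17.48).** A constant `Φ₀ ≥ 0` depending only on
`ι, card Kt, λ, A₀, B₀, M₂` such that: at a point `y` of an open set `O` on which `u ∈ C⁴`, if
`‖D²u(y)‖ ≤ M₂`, the matrix `a` is `λ`-elliptic from below, the finite family of unit coordinate
vectors `γ_k` contains the coordinate directions `e_i` and the diagonals `(e_i ± e_j)/√2`, and
every pure second derivative satisfies the differentiated inequality
`a : D²(D_{γ_kγ_k}u)(y) ≥ −(A₀|D³u(y)| + B₀)` (the output of
`pair_symbolMatrix_hessian_quadHess_ge`), then the normalised functions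
`h_k = ½(1 + D_{γ_kγ_k}u/(1 + M₂)) ∈ [0,1]` satisfy, for every `ε ∈ (0,1]`,
`a : D²(h_k + ε Σ_l h_l²)(y) ≥ −Φ₀/ε` — the Motzkin–Wasow control
`|D³u|² ≤ 4n³(1+M₂)² Σ_k |Dh_k|²` of the third derivatives (polarisation,
`entry_eq_half_diag_sub`, `diag_entry_eq`), `λ Σ|Dh_k|² ≤ Σ a(Dh_k, Dh_k)` and the Cauchy
inequality (`pair_hessian_w_ge`). [cite: GilbargTrudinger2001, §17.4, (17.46)–(17.48)] -/
theorem supersolution_w (ι : Type*) [Fintype ι] [DecidableEq ι] (Kt : Type*) [Fintype Kt]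
    {lam A₀ B₀ M₂ : ℝ} (hlam : 0 < lam) (hA₀ : 0 ≤ A₀) (hB₀ : 0 ≤ B₀) (hM₂ : 0 ≤ M₂) :
    ∃ Φ₀ : ℝ, 0 ≤ Φ₀ ∧
      ∀ {O : Set (EuclideanSpace ℝ ι)}, IsOpen O →
      ∀ {u : EuclideanSpace ℝ ι → ℝ}, ContDiffOn ℝ 4 u O →
      ∀ {y : EuclideanSpace ℝ ι}, y ∈ O → ‖iteratedFDeriv ℝ 2 u y‖ ≤ M₂ →
      ∀ {a : Matrix ι ι ℝ}, (∀ ξ : ι → ℝ, lam * (ξ ⬝ᵥ ξ) ≤ ξ ⬝ᵥ (a *ᵥ ξ)) →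
      ∀ {γ : Kt → ι → ℝ}, (∀ k, γ k ⬝ᵥ γ k = 1) →
        (∀ i, ∃ k, γ k = Pi.single i 1) →
        (∀ i j, i ≠ j →
          (∃ k, γ k = (Real.sqrt 2)⁻¹ • (Pi.single i 1 + Pi.single j 1)) ∧
          (∃ k, γ k = (Real.sqrt 2)⁻¹ • (Pi.single i 1 - Pi.single j 1))) →
        (∀ k, -(A₀ * Real.sqrt (thirdSq u y) + B₀) ≤
          pair a (hessianMatrix (quadHess u (γ k)) (EuclideanSpace.basisFun ι ℝ) y)) →
      ∀ {ε : ℝ}, 0 < ε → ε ≤ 1 → ∀ k,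
        -(Φ₀ / ε) ≤
          pair a (hessianMatrix
            (fun x ↦ (1 + quadHess u (γ k) x / (1 + M₂)) / 2 +
              ε * ∑ l, ((1 + quadHess u (γ l) x / (1 + M₂)) / 2) ^ 2)
            (EuclideanSpace.basisFun ι ℝ) y) := by
  -- the constants of `pair_hessian_w_ge` for the normalised functions `h_k`
  set N : ℝ := (Fintype.card Kt : ℝ) with hN
  set c : ℝ := (2 * (1 + M₂))⁻¹ with hc
  set A : ℝ := c * A₀ with hA
  set B : ℝ := c * B₀ with hB
  set M : ℝ := 4 * (Fintype.card ι : ℝ) ^ 3 * (1 + M₂) ^ 2 + 1 with hM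
  have h1M : 0 < 1 + M₂ := by linarith
  have hc0 : 0 < c := by positivity
  have hA0 : 0 ≤ A := by positivity
  have hB0 : 0 ≤ B := by positivity
  have hM0 : 0 < M := by positivity
  have hN0 : 0 ≤ N := by positivity
  refine ⟨(1 + 2 * N) * B + (1 + 2 * N) ^ 2 * A ^ 2 * M / (8 * lam), by positivity, ?_⟩
  intro O hO u hu y hy hD2 a hell γ hunit hdiag hoff hquad ε hε hε1 k
  set bE := EuclideanSpace.basisFun ι ℝ
  -- the normalised pure second derivatives `h_l`
  set hf : Kt → EuclideanSpace ℝ ι → ℝ :=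
    fun l x ↦ (1 + quadHess u (γ l) x / (1 + M₂)) / 2 with hhf
  -- smoothness at `y`
  have hu4 : ContDiffAt ℝ 4 u y := hu.contDiffAt (hO.mem_nhds hy)
  have hu3 : ContDiffAt ℝ 3 u y := hu4.of_le (by norm_num)
  have hq2 : ∀ l, ContDiffAt ℝ 2 (quadHess u (γ l)) y := fun l ↦ contDiffAt_quadHess hu4 (γ l)
  have h1M' : (1 + M₂) ≠ 0 := h1M.ne'
  have hfe : ∀ l, hf l = fun x ↦ c * quadHess u (γ l) x + 1 / 2 := fun l ↦ by
    funext x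
    simp only [hhf, hc]
    field_simp
    ring
  have hhf2 : ∀ l, ContDiffAt ℝ 2 (hf l) y := fun l ↦ by
    rw [hfe l]; exact (contDiffAt_const.mul (hq2 l)).add contDiffAt_const
  -- `h_l(y) ∈ [0, 1]`
  have hqb : ∀ l, |quadHess u (γ l) y| ≤ M₂ := fun l ↦
    (abs_quadHess_le_norm_iteratedFDeriv u y (hunit l)).trans hD2
  have h0 : ∀ l, 0 ≤ hf l y := fun l ↦ by
    have hl := (abs_le.1 (hqb l)).1
    have : -1 ≤ quadHess u (γ l) y / (1 + M₂) := by rw [le_div_iff₀ h1M]; linarith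
    show 0 ≤ (1 + quadHess u (γ l) y / (1 + M₂)) / 2
    linarith
  have h1 : ∀ l, hf l y ≤ 1 := fun l ↦ by
    have hl := (abs_le.1 (hqb l)).2
    have : quadHess u (γ l) y / (1 + M₂) ≤ 1 := by rw [div_le_iff₀ h1M]; linarith
    show (1 + quadHess u (γ l) y / (1 + M₂)) / 2 ≤ 1
    linarith
  -- Hessians and gradients of the `h_l` at `y`
  set H : Kt → Matrix ι ι ℝ := fun l ↦ hessianMatrix (hf l) bE y
  set g : Kt → ι → ℝ := fun l i ↦ fderiv ℝ (hf l) y (bE i)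
  have hHq : ∀ l, H l = c • hessianMatrix (quadHess u (γ l)) bE y := fun l ↦ by
    show hessianMatrix (hf l) bE y = _
    rw [hfe l]
    exact hessianMatrix_const_mul_add_const bE (hq2 l) c (1 / 2)
  have hgq : ∀ l i, g l i = c * fderiv ℝ (quadHess u (γ l)) y (bE i) := fun l i ↦ by
    show fderiv ℝ (hf l) y (bE i) = _
    rw [hfe l, fderiv_add_const, fderiv_const_mul ((hq2 l).differentiableAt (by norm_num))]
    rfl
  -- (17.46) for the normalised functions
  have hHb : ∀ l, -pair a (H l) ≤ A * Real.sqrt (thirdSq u y) + B := fun l ↦ by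
    rw [hHq l, pair_smul, hA, hB]
    have := mul_le_mul_of_nonneg_left (hquad l) hc0.le
    nlinarith
  -- the Motzkin–Wasow control of the third derivatives
  have hMW : Real.sqrt (thirdSq u y) ^ 2 ≤ M * ∑ l, g l ⬝ᵥ g l := by
    rw [Real.sq_sqrt (thirdSq_nonneg u y)]
    have h3 := thirdSq_le_card_pow_mul_sum hu3 hdiag hoff
    set SF := ∑ k, ∑ i, (fderiv ℝ (quadHess u (γ k)) y (bE i)) ^ 2 with hSF
    have eS : ∑ l, g l ⬝ᵥ g l = c ^ 2 * SF := by
      rw [hSF, Finset.mul_sum]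
      refine Finset.sum_congr rfl fun l _ ↦ ?_
      rw [Finset.mul_sum]
      refine Finset.sum_congr rfl fun i _ ↦ ?_
      rw [hgq l i]
      ring
    have hSg : 0 ≤ ∑ l, g l ⬝ᵥ g l :=
      Finset.sum_nonneg fun l _ ↦ Finset.sum_nonneg fun i _ ↦ mul_self_nonneg _
    have hc2 : c ^ 2 * (4 * (1 + M₂) ^ 2) = 1 := by
      rw [hc]; field_simp; ring
    calc thirdSq u y ≤ (Fintype.card ι : ℝ) ^ 3 * SF := h3
      _ = (4 * (Fintype.card ι : ℝ) ^ 3 * (1 + M₂) ^ 2) * (c ^ 2 * SF) := by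
          linear_combination (-((Fintype.card ι : ℝ) ^ 3 * SF)) * hc2
      _ = M * ∑ l, g l ⬝ᵥ g l - ∑ l, g l ⬝ᵥ g l := by rw [← eS, hM]; ring
      _ ≤ M * ∑ l, g l ⬝ᵥ g l := by linarith
  -- the Hessian of `w_k`
  have hHw : hessianMatrix (fun x ↦ hf k x + ε * ∑ l, hf l x ^ 2) bE y =
      H k + ε • ∑ l, ((2 * hf l y) • H l + (2 : ℝ) • vecMulVec (g l) (g l)) :=
    hessianMatrix_add_mul_sum_sq bE hhf2 ε k
  -- (17.48)
  have key := pair_hessian_w_ge hlam hell h0 h1 hA0 (Real.sqrt_nonneg _) hB0 hM0 hHb hMW hε k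
  rw [← hN] at key
  show -(((1 + 2 * N) * B + (1 + 2 * N) ^ 2 * A ^ 2 * M / (8 * lam)) / ε) ≤
    pair a (hessianMatrix (fun x ↦ hf k x + ε * ∑ l, hf l x ^ 2) bE y)
  rw [hHw]
  refine le_trans (neg_le_neg ?_) key
  have hNε : 1 + 2 * ε * N ≤ 1 + 2 * N := by nlinarith [mul_le_of_le_one_left hN0 hε1]
  have hNε0 : 0 ≤ 1 + 2 * ε * N := by positivity
  rw [le_div_iff₀ hε, add_mul]
  have e1 : (1 + 2 * ε * N) * B * ε ≤ (1 + 2 * N) * B := by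
    have i1 : (1 + 2 * ε * N) * B * ε ≤ (1 + 2 * ε * N) * B :=
      mul_le_of_le_one_right (by positivity) hε1
    have i2 : (1 + 2 * ε * N) * B ≤ (1 + 2 * N) * B := mul_le_mul_of_nonneg_right hNε hB0
    exact i1.trans i2
  have e2 : (1 + 2 * ε * N) ^ 2 * A ^ 2 * M / (8 * ε * lam) * ε =
      (1 + 2 * ε * N) ^ 2 * A ^ 2 * M / (8 * lam) := by
    field_simp
  have e3 : (1 + 2 * ε * N) ^ 2 * A ^ 2 * M / (8 * lam) ≤
      (1 + 2 * N) ^ 2 * A ^ 2 * M / (8 * lam) := by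
    have := pow_le_pow_left₀ hNε0 hNε 2
    exact div_le_div_of_nonneg_right (mul_le_mul_of_nonneg_right
      (mul_le_mul_of_nonneg_right this (sq_nonneg A)) hM0.le) (by positivity)
  linarith

end Literature.Analysis.PDE.EvansKrylov

end
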